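import Summits.CriticalPhenomena.PercolationContinuityZ3.Theorems.PercNearOneGluingNoHeavyLowerTailSahiTransportJR3Data4

/-!
# `NoHeavyLowerTail` (crux stmt-CriticalPhenomena-4575), Sahi / Kahn positivity: three-sample certificates on `2^4` — evaluation (`K₂,₂` orbit)

Support file (cell `prim-l12`, seat P3, gen 5; `--supports stmt-CriticalPhenomena-4575`).  Computational (`native_decide`, ≈ 2 min per mask): the digit
test `SahiTransportJR.checkTab3 38 4 M (certTab4K22 M)` passes for the three masks `61152, 64200, 64680` of type `K₂,₂ = (x₁∨x₂)∧(x₃∨x₄)` —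
the only type of `2^4` without a two-sample parameter-free certificate.  With `…SahiTransportJR3Sound.sahiE_three_nonneg_of_checkTab3` this completes
the certification of all `166` nontrivial increasing pattern events of `2^4` (`…SahiTransportJREval4A–F` for the other `163`). [this work]
-/

namespace Summit.CriticalPhenomena.PercolationContinuityZ3.Theorems.SahiTransportJR

/-- The `K₂,₂` orbit of `2^4`. [this work] -/
def batch4K22 : List ℕ := [61152, 64200, 64680]

/-- Mask `61152 = ⟨ac,bc,ad,bd⟩` passes the three-sample check. [this work] -/
theorem checkTab3_61152 : checkTab3 38 4 61152 (certTab4K22 61152) = true := by native_decide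

/-- Mask `64200` passes the three-sample check. [this work] -/
theorem checkTab3_64200 : checkTab3 38 4 64200 (certTab4K22 64200) = true := by native_decide

/-- Mask `64680` passes the three-sample check. [this work] -/
theorem checkTab3_64680 : checkTab3 38 4 64680 (certTab4K22 64680) = true := by native_decide

/-- Pointwise form over the orbit. [this work] -/
theorem checkTab3_of_mem_batch4K22 {M : ℕ} (h : M ∈ batch4K22) : checkTab3 38 4 M (certTab4K22 M) = true := by
  simp only [batch4K22, List.mem_cons, List.mem_nil_iff, or_false] at h
  rcases h with rfl | rfl | rfl
  · exact checkTab3_61152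
  · exact checkTab3_64200
  · exact checkTab3_64680

end Summit.CriticalPhenomena.PercolationContinuityZ3.Theorems.SahiTransportJR
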